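import Summits.Ventures.LatticeQCDFlow.Scaling.SwapAcceptanceGapSlope

/-!
HONEST FRAMING: exact (Metropolis-corrected) sampling algorithms for lattice gauge theory; figures
of merit are autocorrelation/cost numbers at stated couplings and volumes; no continuum-physics
claim.

# SwapAcceptanceGapCorner — THE EXACT SWAP ACCEPTANCE HAS A CORNER AT COINCIDENCE: SLOPE `−½·GMD` TO THE RIGHT,
# `+½·GMD` TO THE LEFT, NOT DIFFERENTIABLE UNLESS THE TEMPERING STATISTIC IS A.S. CONSTANT (row 22 `su3-ptbc`, GEN-9,
# ours; sequel of `SwapAcceptanceGapSlope`, closing its «NOT CLAIMED: the left derivative / the corner»)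

Venture `LatticeQCDFlow` (cell pub-lqcd), topic `Scaling`; FANOUT row 22 (`su3-ptbc`, PTBC comparator arm E4).  NEW
WORK of the cell over GEN-9's `SwapAcceptanceGapSlope` (`hasDerivWithinAt_swapAcc_gap_gini`: right slope
`−½·E_{μ_s⊗μ_s}|X − X′|`), GEN-8's `SwapAcceptanceMonotone` (`swapAcc_neg`: `swapAcc (−X) μ (−s) (−t) = swapAcc X μ s t`)
and lean-2's `SwapAcceptanceLaw`; Mathlib `HasDerivWithinAt.comp`, `uniqueDiffOn_Ici/Iic`, `HasDerivWithinAt.derivWithin`,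
`integral_eq_zero_iff_of_nonneg`, `Integrable.integral_prod_left`, `absolutelyContinuous_tilted`.  Nothing is cited as
a fact; no numerics.

## What is proved (`μ` a probability measure, `X` bounded measurable, `μ_s := μ.tilted (s·X)`,
## `GMD_s := ∫∫ |X x − X y| dμ_s dμ_s`)

* `swapAcc_sub_eq_neg` — `swapAcc X μ s (s − h) = swapAcc (−X) μ (−s) (−s + h)`: the profile to the LEFT of the base is
  the profile to the right for the reflected family; `gini_neg` — the reflected family at `−s` has the same tilt and the
  same Gini mean difference.
* `hasDerivWithinAt_swapAcc_gap_below` — `h ↦ swapAcc X μ s (s − h)` has right derivative `−½·GMD_s` at `0`;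
  **`hasDerivWithinAt_swapAcc_gap_left`** — the signed-gap profile `g ↦ swapAcc X μ s (s + g)` has derivative
  `+½·GMD_s` within `(−∞, 0]` at `0` (while `SwapAcceptanceGapSlope` gives `−½·GMD_s` within `[0, ∞)`).
* **`gini_eq_zero_of_differentiableAt`** — if the signed-gap profile is differentiable at `0` then `GMD_s = 0`
  (one-sided derivatives are unique at the endpoint of `Ici 0` / `Iic 0` and would both equal the derivative);
  **`not_differentiableAt_swapAcc_gap`** — hence for `X` NOT `μ`-a.e. constant the profile is NOT differentiable at
  coincidence: the acceptance is maximal (`= 1`) at `g = 0` with a genuine KINK, losing `½·GMD_s·|g|` to first order on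
  both sides (`GMD_s = 0` forces `X y = X x` for a.e. `(x, y)`, i.e. `X` a.e. constant, via `μ ≪ μ_s`).

WHY (CARD-su3-ptbc §1.6).  The retune step moves ONE endpoint of a pair; whether it moves the upper coupling down or the
lower coupling up, the first-order acceptance change per unit coupling is the same single-replica statistic `½·GMD`
(of the replica that stays put), and there is no "flat top" to exploit near coincidence — the exact profile is a tent
at first order, for every action.  NOT CLAIMED: second-order terms (the two one-sided curvatures); anything about a run.
-/

noncomputable section

open MeasureTheory ProbabilityTheory Real Set Filter Topology

namespace Summit.Ventures.LatticeQCDFlow.Scaling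

variable {Ω : Type*} [MeasurableSpace Ω] {μ : Measure Ω} [IsProbabilityMeasure μ] {X : Ω → ℝ}

omit [IsProbabilityMeasure μ] in
/-- Moving the partner BELOW the base: `swapAcc X μ s (s − h) = swapAcc (−X) μ (−s) (−s + h)` — the gap profile to
the left is the gap profile to the right of the reflected family. [ours] -/
theorem swapAcc_sub_eq_neg (s h : ℝ) :
    swapAcc X μ s (s - h) = swapAcc (fun ω => -X ω) μ (-s) (-s + h) := by
  rw [← swapAcc_neg s (s - h)]
  congr 1
  ring

omit [IsProbabilityMeasure μ] in
/-- The Gini mean difference is reflection invariant and the reflected tilt at `−s` is the tilt at `s`: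
`∫∫ |(−X) x − (−X) y| dμ^{(−X)}_{−s} dμ^{(−X)}_{−s} = ∫∫ |X x − X y| dμ_s dμ_s`. [folklore] -/
theorem gini_neg (s : ℝ) :
    ∫ x, ∫ y, |(-X x) - (-X y)| ∂(μ.tilted fun ω => -s * -X ω) ∂(μ.tilted fun ω => -s * -X ω)
      = ∫ x, ∫ y, |X x - X y| ∂(μ.tilted fun ω => s * X ω) ∂(μ.tilted fun ω => s * X ω) := by
  have hμ : (μ.tilted fun ω => -s * -X ω) = μ.tilted fun ω => s * X ω := by
    congr 1; funext ω; ring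
  rw [hμ]
  refine integral_congr_ae (ae_of_all _ fun x => integral_congr_ae (ae_of_all _ fun y => ?_))
  show |-X x - -X y| = |X x - X y|
  rw [neg_sub_neg, abs_sub_comm]

/-- **LEFT SLOPE (partner below the base)**: `h ↦ swapAcc X μ s (s − h)` has right derivative
`−½·E_{μ_s⊗μ_s}|X − X′|` at `h = 0` as well. [ours] -/
theorem hasDerivWithinAt_swapAcc_gap_below (hXm : Measurable X) (hXb : ∃ C, ∀ ω, |X ω| ≤ C) (s : ℝ) :
    HasDerivWithinAt (fun h => swapAcc X μ s (s - h))
      (-(1 / 2 * ∫ x, ∫ y, |X x - X y| ∂(μ.tilted fun ω => s * X ω) ∂(μ.tilted fun ω => s * X ω)))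
      (Ici 0) 0 := by
  have hXm' : Measurable fun ω => -X ω := hXm.neg
  have hXb' : ∃ C, ∀ ω, |(fun ω => -X ω) ω| ≤ C := by
    obtain ⟨C, hC⟩ := hXb; exact ⟨C, fun ω => by simpa only [abs_neg] using hC ω⟩
  have h := hasDerivWithinAt_swapAcc_gap_gini (μ := μ) hXm' hXb' (-s)
  rw [gini_neg] at h
  refine h.congr (fun x _ => swapAcc_sub_eq_neg s x) (swapAcc_sub_eq_neg s 0)

/-- **THE SIGNED-GAP PROFILE HAS SLOPE `+½·GMD` FROM THE LEFT**: `g ↦ swapAcc X μ s (s + g)` has derivative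
`+½·E_{μ_s⊗μ_s}|X − X′|` within `(−∞, 0]` at `g = 0`. [ours] -/
theorem hasDerivWithinAt_swapAcc_gap_left (hXm : Measurable X) (hXb : ∃ C, ∀ ω, |X ω| ≤ C) (s : ℝ) :
    HasDerivWithinAt (fun g => swapAcc X μ s (s + g))
      (1 / 2 * ∫ x, ∫ y, |X x - X y| ∂(μ.tilted fun ω => s * X ω) ∂(μ.tilted fun ω => s * X ω))
      (Iic 0) 0 := by
  have h := hasDerivWithinAt_swapAcc_gap_below (μ := μ) hXm hXb s
  -- compose with `g ↦ −g`, which maps `Iic 0` onto `Ici 0`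
  have hneg : HasDerivWithinAt (fun g : ℝ => -g) (-1) (Iic 0) 0 := (hasDerivAt_neg 0).hasDerivWithinAt
  have hmaps : MapsTo (fun g : ℝ => -g) (Iic 0) (Ici 0) := fun g hg => by
    simp only [mem_Iic] at hg; simp only [mem_Ici]; linarith
  have h' : HasDerivWithinAt (fun h => swapAcc X μ s (s - h))
      (-(1 / 2 * ∫ x, ∫ y, |X x - X y| ∂(μ.tilted fun ω => s * X ω) ∂(μ.tilted fun ω => s * X ω)))
      (Ici 0) ((fun g : ℝ => -g) 0) := by simpa only [neg_zero] using h
  have hc := h'.comp (0 : ℝ) hneg hmaps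
  have heq : (fun h => swapAcc X μ s (s - h)) ∘ (fun g : ℝ => -g) = fun g => swapAcc X μ s (s + g) := by
    funext g; simp [sub_neg_eq_add]
  rw [heq] at hc
  refine hc.congr_deriv ?_
  ring

/-- **THE CORNER**: the signed-gap profile `g ↦ swapAcc X μ s (s + g)` is differentiable at `g = 0` only if the Gini
mean difference vanishes, i.e. (for bounded `X`) only if `X` is `μ`-a.e. constant on the support — the acceptance has a
genuine kink at coincidence, maximal value `1` with first-order loss on BOTH sides. [ours] -/
theorem gini_eq_zero_of_differentiableAt (hXm : Measurable X) (hXb : ∃ C, ∀ ω, |X ω| ≤ C) (s : ℝ)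
    (hd : DifferentiableAt ℝ (fun g => swapAcc X μ s (s + g)) 0) :
    ∫ x, ∫ y, |X x - X y| ∂(μ.tilted fun ω => s * X ω) ∂(μ.tilted fun ω => s * X ω) = 0 := by
  set G : ℝ := ∫ x, ∫ y, |X x - X y| ∂(μ.tilted fun ω => s * X ω) ∂(μ.tilted fun ω => s * X ω) with hG
  have hR := hasDerivWithinAt_swapAcc_gap_gini (μ := μ) hXm hXb s
  have hL := hasDerivWithinAt_swapAcc_gap_left (μ := μ) hXm hXb s
  have hD := hd.hasDerivAt
  -- one-sided derivatives are unique on `Ici 0` / `Iic 0` and must both equal the two-sided one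
  have hU1 : UniqueDiffWithinAt ℝ (Ici (0 : ℝ)) 0 := uniqueDiffOn_Ici 0 0 self_mem_Ici
  have hU2 : UniqueDiffWithinAt ℝ (Iic (0 : ℝ)) 0 := uniqueDiffOn_Iic 0 0 self_mem_Iic
  have e1 : derivWithin (fun g => swapAcc X μ s (s + g)) (Ici 0) 0 = -(1 / 2 * G) := hR.derivWithin hU1
  have e1' : derivWithin (fun g => swapAcc X μ s (s + g)) (Ici 0) 0
      = deriv (fun g => swapAcc X μ s (s + g)) 0 := hD.hasDerivWithinAt.derivWithin hU1
  have e2 : derivWithin (fun g => swapAcc X μ s (s + g)) (Iic 0) 0 = 1 / 2 * G := hL.derivWithin hU2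
  have e2' : derivWithin (fun g => swapAcc X μ s (s + g)) (Iic 0) 0
      = deriv (fun g => swapAcc X μ s (s + g)) 0 := hD.hasDerivWithinAt.derivWithin hU2
  linarith

/-- **NON-DEGENERATE STATISTIC ⇒ A GENUINE KINK**: if `X` is not `μ`-a.e. constant, the signed-gap profile
`g ↦ swapAcc X μ s (s + g)` is NOT differentiable at `g = 0` (a vanishing Gini mean difference under `μ_s ∼ μ` would
make `X` a.e. constant). [ours] -/
theorem not_differentiableAt_swapAcc_gap (hXm : Measurable X) (hXb : ∃ C, ∀ ω, |X ω| ≤ C)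
    (hnd : ∀ c : ℝ, ¬ (X =ᵐ[μ] fun _ => c)) (s : ℝ) :
    ¬ DifferentiableAt ℝ (fun g => swapAcc X μ s (s + g)) 0 := by
  intro hd
  set μs : Measure Ω := μ.tilted fun ω => s * X ω with hμs
  haveI : IsProbabilityMeasure μs := isProbabilityMeasure_tilted_mul hXm hXb s
  have hG := gini_eq_zero_of_differentiableAt (μ := μ) hXm hXb s hd
  rw [← hμs] at hG
  obtain ⟨C, hC⟩ := hXb
  -- the pair integrand is bounded, so the iterated integral is an honest double integral
  have hDm : Measurable fun z : Ω × Ω => |X z.1 - X z.2| :=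
    ((hXm.comp measurable_fst).sub (hXm.comp measurable_snd)).abs
  have hDb : ∀ z : Ω × Ω, |(fun z : Ω × Ω => |X z.1 - X z.2|) z| ≤ 2 * C := by
    intro z
    rw [abs_abs]
    calc |X z.1 - X z.2| ≤ |X z.1| + |X z.2| := abs_sub _ _
      _ ≤ C + C := add_le_add (hC _) (hC _)
      _ = 2 * C := by ring
  have hDi : Integrable (fun z : Ω × Ω => |X z.1 - X z.2|) (μs.prod μs) := integrable_of_abs_le hDm hDb
  have hFi : Integrable (fun x => ∫ y, |X x - X y| ∂μs) μs := hDi.integral_prod_left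
  have hF0 : ∀ x, 0 ≤ ∫ y, |X x - X y| ∂μs := fun x => integral_nonneg fun y => abs_nonneg _
  have hFae : (fun x => ∫ y, |X x - X y| ∂μs) =ᵐ[μs] 0 :=
    (integral_eq_zero_iff_of_nonneg (fun x => hF0 x) hFi).1 hG
  -- for a.e. `x`, `X y = X x` for a.e. `y`
  have hrow : ∀ᵐ x ∂μs, ∀ᵐ y ∂μs, X y = X x := by
    filter_upwards [hFae] with x hx
    have hyi : Integrable (fun y => |X x - X y|) μs :=
      integrable_of_abs_le ((measurable_const.sub hXm).abs) (C := 2 * C) fun y => by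
        rw [abs_abs]
        calc |X x - X y| ≤ |X x| + |X y| := abs_sub _ _
          _ ≤ C + C := add_le_add (hC _) (hC _)
          _ = 2 * C := by ring
    have h0 := (integral_eq_zero_iff_of_nonneg (fun y => abs_nonneg _) hyi).1 hx
    filter_upwards [h0] with y hy
    have : |X x - X y| = 0 := hy
    linarith [abs_eq_zero.1 this]
  obtain ⟨x₀, hx₀⟩ := hrow.exists
  have hac : μ ≪ μs := absolutelyContinuous_tilted (integrable_exp_mul_of_bounded hXm ⟨C, hC⟩ s)
  exact hnd (X x₀) (hac.ae_le hx₀)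

end Summit.Ventures.LatticeQCDFlow.Scaling

end
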